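import Summits.AtomisticToContinuum.Crystallization.Theorems.ChargedEnergyGapExposureDial
import Summits.AtomisticToContinuum.Crystallization.Theorems.ChargedEnergyGapGrossSurgery
import HarnessLib

/-!
# `ChargedEnergyGap` — periodic-to-block transfer of rattlers and holes
# (cell `decomp-a2c`, lens 3, generation 42, node «ExposedTransfer», part C1 of C1/C2)

Leaf of record (critic row 847): `[GE] ExposedGrossPricing (3/20) (1/10) (6/5)` of the exact exposure dial
`grossChargeGap_iff_exposed_compact : GrossChargeGap θ ↔ ExposedGrossPricing θ ε R ∧ CompactGrossGap θ ε R` (part B,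
`ChargedEnergyGapExposureDial`) beneath the gross piece `[G] GrossChargeGap (3/20)` of the chart dial of the shared crux
`PricedLinkCensus.ChargedEnergyGap` (`stmt-AtomisticToContinuum-14231`).  It is PROVED in part C2
(`ChargedEnergyGapExposedPricing.exposedGrossPricing_record`) by transferring the finite pricing of exposed sites
(`ChargedEnergyGapGrossSurgery.card_exposed_le_excess`, part D, all injective finite configurations) to periodic `Q` through
the BLOCKS `Q_K` of the tree (`ChargedEnergyGap.Negative.Blocks*`).  THIS FILE is the transfer dictionary:

* §0 the species `motifExposed ε R Q = #{exposed motif sites}` (⊇ the exposed gross charged sites of part B);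
* §1 at a `depth(ρ)`-deep block point `u = (x,k)` (`ρ ≥ 9/10`) an `ε`-rattler `x` of `Q` is an `ε`-rattler of the finite block
  configuration — the block site energy is the full lattice sum minus a tail of NON-POSITIVE terms (`le_dist_of_deep`,
  `lennardJones_dist_nonpos`): LOSSLESS (`rattler_block`);
* §2 an `ε`-hole `z` of `Q` translates by periods (`isHole_add`: off the configuration the field `φ_Q` is the tree's lattice
  sum `siteSum`, `holeField_eq_siteSum`, translation invariant `siteSum_add`), and at a hole within `R` of a `depth(ρ)`-deep
  block point, `ρ ≥ 2R`, the BLOCK field is at most `e* − ε + (64/6)·farSix(x, ρ)` (`sum_block_field_le`): the missing terms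
  `q ∉ block` have `|u − q| ≥ ρ`, so `|z − q| ≥ |u − q|/2` and `V(|z − q|) ≥ −(1/6)|z − q|⁻⁶ ≥ −(64/6)|u − q|⁻⁶`, and the
  sixth-power sum over the non-block points is `≤ farSix` (`tsum_six_compl_le_farSix`, translation invariance `farSix_add`);
* §3 the deep exposed block points number `≥ #{deep k}·motifExposed` (`card_deep_exposed_ge`), read through the `Fin`
  labelling of the block configuration (`card_filter_equivFin`).

All `[this work]`; every ingredient is a tree `[folklore]` lemma named in place.
-/

noncomputable section

open scoped BigOperators
open Literature.MathematicalPhysics.StatisticalMechanics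
open Literature.Geometry.DiscreteGeometry
open Summit.AtomisticToContinuum.Crystallization.Theses.PricedLinkCensus
open Summit.AtomisticToContinuum.Crystallization.Theorems.ChargedEnergyGapNegative
open Summit.AtomisticToContinuum.Crystallization.Theorems.ChargedEnergyGapNegative.Blocks
open Summit.AtomisticToContinuum.Crystallization.Theorems.ChargedEnergyGapGrossSurgery
  (lennardJones_dist_nonpos sum_univ_eq_siteEnergy)

namespace Summit.AtomisticToContinuum.Crystallization.Theorems.ChargedEnergyGapChartDial

/-! ## §0 The species: ALL exposed motif sites -/

/-- Number of EXPOSED motif sites (`ε`-rattler or within `R` of an `ε`-hole), irrespective of charge and chart. [this work] -/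
def motifExposed (ε R : ℝ) (Q : PeriodicConfiguration 3) : ℕ :=
  Nat.card {x : Q.motif // Exposed ε R Q x}

/-- The exposed GROSS CHARGED sites are among the exposed sites. -/
theorem motifGrossExposed_le_motifExposed (θ ε R : ℝ) (Q : PeriodicConfiguration 3) :
    motifGrossExposed θ ε R Q ≤ motifExposed ε R Q :=
  Nat.card_le_card_of_injective
    (fun x : {x : Q.motif // (Charged Q x ∧ ¬ ChartedAt θ Q (pt Q x)) ∧ Exposed ε R Q x} =>
      (⟨x.1, x.2.2⟩ : {x : Q.motif // Exposed ε R Q x}))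
    (fun x y h => Subtype.ext (by have h' := congrArg Subtype.val h; simpa using h'))

/-! ## §1 Site energies: periodic vs. block; rattlers transfer losslessly to deep block points -/

section Transfer

variable (Q : PeriodicConfiguration 3) (K : ℕ)

/-- `u_Q(x) = 2·siteEnergy Q x` is the tree's lattice sum `Blocks.siteSum Q V_LJ x` (definitional). -/
theorem two_mul_siteEnergy_eq_siteSum (x : E3) : 2 * siteEnergy Q x = siteSum Q lennardJones x := by
  unfold siteEnergy siteSum
  ring

/-- The finite site energy of the block configuration at the label of the block index `u` is the full lattice sum at `u`'s
motif point minus the tail over the points outside the block (tree `Blocks.sum_row_eq`). -/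
theorem siteEnergy_blockConfig (u : BIdx Q K) :
    Literature.MathematicalPhysics.StatisticalMechanics.siteEnergy lennardJones (blockConfig Q K)
        (Fintype.equivFin (BIdx Q K) u) = siteSum Q lennardJones u.1 - tail Q K lennardJones u := by
  rw [← sum_row_eq Q K u, ← sum_univ_eq_siteEnergy]
  simp only [blockConfig_apply, Equiv.symm_apply_apply]
  exact (Fintype.equivFin (BIdx Q K)).symm.sum_comp (fun v => lennardJones (dist (bpt Q K u) (bpt Q K v)))

/-- At a `depth(ρ)`-deep block point, `ρ ≥ 9/10`, the tail consists of non-positive terms. -/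
theorem tail_nonpos_of_deep {ρ : ℝ} (hρ : 9 / 10 ≤ ρ) {u : BIdx Q K} (hdeep : IsDeep K (depth Q ρ) u.2) :
    tail Q K lennardJones u ≤ 0 := by
  unfold tail
  exact tsum_nonpos fun q => lennardJones_dist_nonpos
    (hρ.trans (le_dist_of_deep Q K hdeep q.1 fun h => (Set.mem_compl_iff _ _).1 q.2 (Finset.mem_coe.2 h)))

/-- **Rattlers transfer** (lossless): an `ε`-rattler of `Q` sits at every `depth(ρ)`-deep block point over it as an
`ε`-rattler of the finite block configuration. -/
theorem rattler_block {ε ρ : ℝ} (hρ : 9 / 10 ≤ ρ) {u : BIdx Q K} (hdeep : IsDeep K (depth Q ρ) u.2)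
    (hr : Rattler ε Q u.1) :
    eStar + ε ≤ Literature.MathematicalPhysics.StatisticalMechanics.siteEnergy lennardJones (blockConfig Q K)
      (Fintype.equivFin (BIdx Q K) u) := by
  rw [siteEnergy_blockConfig]
  have h1 := two_mul_siteEnergy_eq_siteSum Q (u.1 : E3)
  have h2 := tail_nonpos_of_deep Q K hρ hdeep
  unfold Rattler at hr
  linarith

/-! ## §2 Holes: the field off the configuration, translation, and the block field at a translated hole -/

/-- Off the configuration, "the other points" are all the points. -/
def offEquiv {z : E3} (hz : z ∉ Q.points) : {q : E3 // q ∈ Q.points ∧ q ≠ z} ≃ Q.points where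
  toFun q := ⟨q.1, q.2.1⟩
  invFun q := ⟨q.1, q.2, fun h => hz (h ▸ q.2)⟩
  left_inv _ := rfl
  right_inv _ := rfl

/-- Off the configuration the field is the tree's lattice sum: `φ_Q(z) = siteSum Q V_LJ z` (`z ∉ Q.points`). -/
theorem holeField_eq_siteSum {z : E3} (hz : z ∉ Q.points) : holeField Q z = siteSum Q lennardJones z := by
  unfold holeField siteSum
  exact (Equiv.tsum_eq (offEquiv Q hz) fun q : Q.points => lennardJones (dist z (q : E3))).symm

/-- The field is summable over `Q.points` at every point off the configuration. -/
theorem summable_field {z : E3} (hz : z ∉ Q.points) :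
    Summable fun q : Q.points => lennardJones (dist z (q : E3)) :=
  (offEquiv Q hz).summable_iff.1 (Q.summable_lennardJones_dist_three z)

/-- A hole is off the configuration. -/
theorem not_mem_points_of_isHole {ε : ℝ} {z : E3} (h : IsHole ε Q z) : z ∉ Q.points := fun hz => by
  have := h.1 z hz
  rw [dist_self] at this
  norm_num at this

/-- **Holes translate**: `z` an `ε`-hole of `Q`, `g` a period ⟹ `z + g` an `ε`-hole of `Q` (clearance and field are
invariant: `Blocks.siteSum_add`). -/
theorem isHole_add {ε : ℝ} {z g : E3} (hg : g ∈ Q.lattice) (h : IsHole ε Q z) : IsHole ε Q (z + g) := by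
  have hclear : ∀ q ∈ Q.points, (1 : ℝ) / 2 ≤ dist (z + g) q := by
    intro q hq
    have hq' : q - g ∈ Q.points := by
      have := Q.add_mem_points hq (Q.lattice.neg_mem hg)
      simpa [sub_eq_add_neg] using this
    have := h.1 (q - g) hq'
    have e : dist (z + g) q = dist z (q - g) := by
      rw [dist_eq_norm, dist_eq_norm]
      congr 1
      abel
    rwa [e]
  refine ⟨hclear, ?_⟩
  have hz := not_mem_points_of_isHole Q h
  have hzg : z + g ∉ Q.points := fun hmem => by
    have := hclear _ hmem
    rw [dist_self] at this
    norm_num at this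
  rw [holeField_eq_siteSum Q hzg, siteSum_add Q lennardJones hg, ← holeField_eq_siteSum Q hz]
  exact h.2

/-- The finite field of the block configuration is the block part of the lattice sum. -/
theorem holeField_blockConfig (z : E3) :
    ChargedEnergyGapGrossSurgery.holeField (blockConfig Q K) z = ∑ v : BIdx Q K, lennardJones (dist z (bpt Q K v)) := by
  unfold ChargedEnergyGapGrossSurgery.holeField
  simp only [blockConfig_apply]
  exact (Fintype.equivFin (BIdx Q K)).symm.sum_comp (fun v => lennardJones (dist z (bpt Q K v)))

/-- The block as a finite set of points of `Q`. [this work] -/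
def blockImage : Finset Q.points := (Finset.univ : Finset (BIdx Q K)).image (toP Q K)

/-- Sums over the block image are sums over block indices. -/
theorem sum_blockImage (g : Q.points → ℝ) : ∑ q ∈ blockImage Q K, g q = ∑ v : BIdx Q K, g (toP Q K v) :=
  Finset.sum_image fun _ _ _ _ h => toP_injective Q K h

/-- Points of `Q` outside the block are `≥ ρ` from a `depth(ρ)`-deep block point (tree `exists_eq_toP_of_dist_lt`). -/
theorem le_dist_of_not_mem_blockImage {ρ : ℝ} {u : BIdx Q K} (hdeep : IsDeep K (depth Q ρ) u.2) (q : Q.points)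
    (hq : q ∉ blockImage Q K) : ρ ≤ dist (bpt Q K u) q := by
  by_contra hlt
  push Not at hlt
  have hne : q ≠ toP Q K u := fun h => hq (Finset.mem_image.2 ⟨u, Finset.mem_univ _, h.symm⟩)
  obtain ⟨v, -, hv⟩ := exists_eq_toP_of_dist_lt Q K hdeep q hne hlt
  exact hq (Finset.mem_image.2 ⟨v, Finset.mem_univ _, hv⟩)

/-- A non-block point, seen from a deep block point `u`, as a far "other point" of `u`. -/
def farEmb {ρ : ℝ} {u : BIdx Q K} (hdeep : IsDeep K (depth Q ρ) u.2) (q : ↥((blockImage Q K : Set Q.points)ᶜ)) :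
    {q : {q : E3 // q ∈ Q.points ∧ q ≠ bpt Q K u} // ρ ≤ dist (bpt Q K u) q.1} :=
  ⟨⟨(q.1 : E3), q.1.2, fun h => (Set.mem_compl_iff _ _).1 q.2
      (Finset.mem_coe.2 (Finset.mem_image.2 ⟨u, Finset.mem_univ _, Subtype.ext h.symm⟩))⟩,
    le_dist_of_not_mem_blockImage Q K hdeep q.1 fun h => (Set.mem_compl_iff _ _).1 q.2 (Finset.mem_coe.2 h)⟩

/-- The far embedding of the outside-the-block points is injective. [formal bookkeeping] -/
theorem farEmb_injective {ρ : ℝ} {u : BIdx Q K} (hdeep : IsDeep K (depth Q ρ) u.2) :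
    Function.Injective (farEmb Q K hdeep) := by
  intro a b h
  have h' : ((farEmb Q K hdeep a).1.1 : E3) = (farEmb Q K hdeep b).1.1 := by rw [h]
  exact Subtype.ext (Subtype.ext h')

/-- The sixth-power sum over the NON-block points at a deep block point is summable and at most `farSix(u, ρ)`. -/
theorem tsum_six_compl_le_farSix {ρ : ℝ} {u : BIdx Q K} (hdeep : IsDeep K (depth Q ρ) u.2) :
    Summable (fun q : ↥((blockImage Q K : Set Q.points)ᶜ) => six (dist (bpt Q K u) (q.1 : E3))) ∧
      ∑' q : ↥((blockImage Q K : Set Q.points)ᶜ), six (dist (bpt Q K u) (q.1 : E3)) ≤ farSix Q (bpt Q K u) ρ := by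
  have hg6 : Summable fun q : {q : {q : E3 // q ∈ Q.points ∧ q ≠ bpt Q K u} // ρ ≤ dist (bpt Q K u) q.1} =>
      six (dist (bpt Q K u) q.1.1) :=
    (summable_six Q (bpt Q K u)).subtype fun q => ρ ≤ dist (bpt Q K u) q.1
  have hf6 : Summable (fun q : ↥((blockImage Q K : Set Q.points)ᶜ) => six (dist (bpt Q K u) (q.1 : E3))) := by
    -- (elaborated in two steps: the direct term makes the unifier solve `?f ∘ ?i = …` too early)
    have h := hg6.comp_injective (farEmb_injective Q K hdeep)
    exact h
  refine ⟨hf6, ?_⟩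
  unfold farSix
  exact Summable.tsum_le_tsum_of_inj (farEmb Q K hdeep) (farEmb_injective Q K hdeep) (fun c _ => six_nonneg _)
    (fun q => le_rfl) hf6 hg6

/-- Termwise: at a non-block point `q` (so `|u − q| ≥ ρ ≥ 2R`, `ρ > 0`) and a point `z` off `Q` within `R` of `u`,
`V(|z − q|) ≥ −(64/6)|u − q|⁻⁶`. -/
theorem field_term_ge {R ρ : ℝ} (hρR : 2 * R ≤ ρ) (hρ0 : 0 < ρ) {u : BIdx Q K}
    (hdeep : IsDeep K (depth Q ρ) u.2) {z : E3} (hzQ : z ∉ Q.points) (hnear : dist (bpt Q K u) z ≤ R)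
    (q : Q.points) (hq : q ∉ blockImage Q K) :
    -(64 / 6 * six (dist (bpt Q K u) q)) ≤ lennardJones (dist z (q : E3)) := by
  have hd : ρ ≤ dist (bpt Q K u) q := le_dist_of_not_mem_blockImage Q K hdeep q hq
  have htri := dist_triangle (bpt Q K u) z (q : E3)
  have hzq : dist (bpt Q K u) q / 2 ≤ dist z q := by linarith
  have hzq0 : 0 < dist (bpt Q K u) q / 2 := by linarith
  have hzne : 0 < dist z (q : E3) := dist_pos.2 fun h => hzQ (h ▸ q.2)
  have h6 : six (dist z q) ≤ 64 * six (dist (bpt Q K u) q) := by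
    unfold six
    have hi : (dist z (q : E3))⁻¹ ≤ (dist (bpt Q K u) q / 2)⁻¹ := inv_anti₀ hzq0 hzq
    have h0 : 0 ≤ (dist z (q : E3))⁻¹ := inv_nonneg.2 dist_nonneg
    have h2 : (dist (bpt Q K u) (q : E3) / 2)⁻¹ = 2 * (dist (bpt Q K u) q)⁻¹ := by
      rw [inv_div, div_eq_mul_inv]
    calc (dist z (q : E3))⁻¹ ^ 6 ≤ ((dist (bpt Q K u) q / 2)⁻¹) ^ 6 := pow_le_pow_left₀ h0 hi 6
      _ = 64 * (dist (bpt Q K u) (q : E3))⁻¹ ^ 6 := by rw [h2, mul_pow]; norm_num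
  have hV := neg_six_le_lennardJones hzne
  linarith

/-- The field splits into the block part and the tail over the non-block points. -/
theorem holeField_eq_sum_add_tsum {z : E3} (hzQ : z ∉ Q.points) :
    holeField Q z = ∑ v : BIdx Q K, lennardJones (dist z (bpt Q K v)) +
      ∑' q : ↥((blockImage Q K : Set Q.points)ᶜ), lennardJones (dist z (q.1 : E3)) := by
  have h1 : ∑ q ∈ blockImage Q K, lennardJones (dist z (q : E3)) = ∑ v : BIdx Q K, lennardJones (dist z (bpt Q K v)) := by
    rw [sum_blockImage]
    simp only [val_toP]
  rw [← h1]
  exact ((summable_field Q hzQ).sum_add_tsum_compl (s := blockImage Q K)).symm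

/-- **The block field at a hole near a deep block point**: if `u` is `depth(ρ)`-deep with `ρ ≥ 2R`, `ρ > 0`, and `z` is an
`ε`-hole of `Q` within `R` of the block point `u`, then
`Σ_{v ∈ block} V(|z − v|) ≤ e* − ε + (64/6)·farSix(x_u, ρ)`: the missing terms `q ∉ block` satisfy `|u − q| ≥ ρ`, hence
`|z − q| ≥ |u − q|/2` and `V(|z − q|) ≥ −(1/6)|z − q|⁻⁶ ≥ −(64/6)|u − q|⁻⁶`. -/
theorem sum_block_field_le {ε R ρ : ℝ} (hρR : 2 * R ≤ ρ) (hρ0 : 0 < ρ) {u : BIdx Q K}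
    (hdeep : IsDeep K (depth Q ρ) u.2) {z : E3} (hz : IsHole ε Q z) (hnear : dist (bpt Q K u) z ≤ R) :
    ∑ v : BIdx Q K, lennardJones (dist z (bpt Q K v)) ≤ eStar - ε + 64 / 6 * farSix Q u.1 ρ := by
  have hzQ : z ∉ Q.points := not_mem_points_of_isHole Q hz
  have hsplit := holeField_eq_sum_add_tsum Q K hzQ
  obtain ⟨hf6, hsix⟩ := tsum_six_compl_le_farSix Q K hdeep (u := u)
  have htail : -(64 / 6 * farSix Q (bpt Q K u) ρ) ≤
      ∑' q : ↥((blockImage Q K : Set Q.points)ᶜ), lennardJones (dist z (q.1 : E3)) := by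
    have h1 : ∑' q : ↥((blockImage Q K : Set Q.points)ᶜ), -(64 / 6 * six (dist (bpt Q K u) (q.1 : E3))) ≤
        ∑' q : ↥((blockImage Q K : Set Q.points)ᶜ), lennardJones (dist z (q.1 : E3)) :=
      Summable.tsum_le_tsum
        (fun q => field_term_ge Q K hρR hρ0 hdeep hzQ hnear q.1
          fun h => (Set.mem_compl_iff _ _).1 q.2 (Finset.mem_coe.2 h))
        (hf6.mul_left (64 / 6)).neg ((summable_field Q hzQ).subtype (· ∈ (blockImage Q K : Set Q.points)ᶜ))
    rw [tsum_neg, tsum_mul_left] at h1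
    linarith
  have hfx : farSix Q (bpt Q K u) ρ = farSix Q u.1 ρ := farSix_add Q (latVec_mem Q (coords K u.2)) _ ρ
  have hhole := hz.2
  rw [hfx] at htail
  linarith [hsplit, htail, hhole]

/-! ## §3 Counting deep exposed block points -/

/-- The deep block points over exposed motif sites. -/
theorem card_deep_exposed_ge (d : ℕ) (ε R : ℝ) :
    Nat.card {k : Fin 3 → Fin K // IsDeep K d k} * motifExposed ε R Q ≤
      Nat.card {u : BIdx Q K // IsDeep K d u.2 ∧ Exposed ε R Q u.1} := by
  classical
  let f : {k : Fin 3 → Fin K // IsDeep K d k} × {x : Q.motif // Exposed ε R Q x} →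
      {u : BIdx Q K // IsDeep K d u.2 ∧ Exposed ε R Q u.1} :=
    fun p => ⟨(p.2.1, p.1.1), p.1.2, p.2.2⟩
  have hf : Function.Injective f := by
    rintro ⟨⟨k, hk⟩, ⟨x, hx⟩⟩ ⟨⟨k', hk'⟩, ⟨x', hx'⟩⟩ h
    have h' := congrArg (fun w => w.1) h
    simp only [f] at h'
    obtain ⟨rfl, rfl⟩ := Prod.ext_iff.1 h'
    rfl
  have := Nat.card_le_card_of_injective f hf
  rw [Nat.card_prod] at this
  unfold motifExposed
  exact this

/-- A predicate on block indices, read through the `Fin` labelling of the block configuration, cuts out as many labels. -/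
theorem card_filter_equivFin (P : BIdx Q K → Prop) [DecidablePred P] :
    ((Finset.univ.filter fun a : Fin (Fintype.card (BIdx Q K)) => P ((Fintype.equivFin (BIdx Q K)).symm a)).card :
        ℝ) = Nat.card {u : BIdx Q K // P u} := by
  classical
  have h1 : Nat.card {u : BIdx Q K // P u} =
      Nat.card {a : Fin (Fintype.card (BIdx Q K)) // P ((Fintype.equivFin (BIdx Q K)).symm a)} :=
    Nat.card_congr ((Fintype.equivFin (BIdx Q K)).subtypeEquiv fun u => by simp)
  rw [h1, Nat.card_eq_fintype_card, Fintype.card_subtype]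

end Transfer

end Summit.AtomisticToContinuum.Crystallization.Theorems.ChargedEnergyGapChartDial

end
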